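import Mathlib
import Summits.MatrixMultiplication.Statement
import Summits.MatrixMultiplication.MatrixMultiplication.Theorems.GraphEquationsTowerStageAlgebra
import Summits.MatrixMultiplication.MatrixMultiplication.Theorems.GraphEquationsAffineDeflation

/-!
# Graph equations — the frame of the generic-point tower (M23c)

Data and bookkeeping of ONE stage of the pivot-normalised identity tower (NODE-g36 §3) over an
arbitrary field `K ⊇ ℂ[a,b]` (the supply theorem takes `K = ℂ(a,b)`):

* the ring at kernel-index type `κ` is `ℂ[a,b,c,Λ_κ] = MvPolynomial (GraphVars n ⊕ κ) ℂ`, its fibre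
  coordinates are `(Fin n × Fin n) ⊕ κ` (`c_q` and `Λ`), the next index type is
  `κ ⊕ ((Fin n × Fin n) ⊕ κ)` (one fresh variable per fibre coordinate), embedded by
  `ι = Sum.map id Sum.inl`;
* `towerPt lam` — the `K`-point `(a, b, ab, lam)`; `towerRow lam g` — the fibre gradient of `g` there;
* `liftDer D` — an old stage derivation transported to the next ring (zero on fresh variables);
  `stageDer` — the new stage derivation `∑_x λ_x ∂_x` (cost-free values, kills `a, b`);
* the formula `stageDer (ι g) = ∑_y ι(∂_y g) · λ_y`, its value `∑_y row(g)_y μ_y` at the next point and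
  its fresh-block gradient `row(g)`; rows and values of embedded polynomials, generators and
  normalisers `λ_x - w`.
-/

set_option linter.dupNamespace false

noncomputable section

open scoped BigOperators

namespace Summit.MatrixMultiplication.MatrixMultiplication.Theorems.GraphEquations

open MvPolynomial
open Literature.Computability.AlgebraicComplexity

variable {n : ℕ}

section Frame

variable {K : Type*} [Field K] [Algebra ℂ K] [Algebra (MvPolynomial (MatMulVars n) ℂ) K]
variable {κ : Type} [Fintype κ] [DecidableEq κ]

/-! ### The point and the rows -/

/-- The `K`-point `(a, b, ab, lam)` of `ℂ[a,b,c,Λ_κ]`: base coordinates go to `ℂ[a,b] ⊆ K` through the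
graph restriction (`c_q ↦ (ab)_q`), kernel variables to `lam`. -/
def towerPt (lam : κ → K) : GraphVars n ⊕ κ → K :=
  Sum.elim (fun v => algebraMap (MvPolynomial (MatMulVars n) ℂ) K (graphRestrict n (X v))) lam

/-- The FIBRE GRADIENT of `g` at the point: `y ↦ (∂_y g)(towerPt lam)` over the fibre coordinates
`y ∈ (Fin n × Fin n) ⊕ κ` (`c_q` and `Λ`). -/
def towerRow (lam : κ → K) (g : MvPolynomial (GraphVars n ⊕ κ) ℂ) : (Fin n × Fin n) ⊕ κ → K :=
  fun y => aeval (towerPt lam) (pderiv (Sum.elim (fun q => Sum.inl (Sum.inr q)) Sum.inr y) g)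

omit [Fintype κ] [DecidableEq κ] in
/-- Unfolding of `towerRow`. -/
theorem towerRow_apply (lam : κ → K) (g : MvPolynomial (GraphVars n ⊕ κ) ℂ) (y) :
    towerRow lam g y =
      aeval (towerPt lam) (pderiv (Sum.elim (fun q => Sum.inl (Sum.inr q)) Sum.inr y) g) := rfl

omit [Fintype κ] [DecidableEq κ] in
/-- Embedded base polynomials evaluate through the graph restriction. -/
theorem aeval_towerPt_rename_inl [IsScalarTower ℂ (MvPolynomial (MatMulVars n) ℂ) K]
    (lam : κ → K) (t : MvPolynomial (GraphVars n) ℂ) :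
    aeval (towerPt lam) (rename Sum.inl t : MvPolynomial (GraphVars n ⊕ κ) ℂ) =
      algebraMap (MvPolynomial (MatMulVars n) ℂ) K (graphRestrict n t) := by
  rw [aeval_rename]
  have : (aeval (towerPt lam ∘ Sum.inl) : MvPolynomial (GraphVars n) ℂ →ₐ[ℂ] K) =
      (IsScalarTower.toAlgHom ℂ (MvPolynomial (MatMulVars n) ℂ) K).comp
        ⟨graphRestrict n, fun c => by simp [graphRestrict_apply, liftF]⟩ := by
    refine MvPolynomial.algHom_ext fun v => ?_
    simp [towerPt]
  exact congrArg (fun φ : MvPolynomial (GraphVars n) ℂ →ₐ[ℂ] K => φ t) this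

omit [Fintype κ] [DecidableEq κ] in
/-- Members of the graph ideal vanish at the point. -/
theorem aeval_towerPt_rename_inl_eq_zero [IsScalarTower ℂ (MvPolynomial (MatMulVars n) ℂ) K]
    (lam : κ → K) {t : MvPolynomial (GraphVars n) ℂ}
    (ht : t ∈ graphIdeal n) :
    aeval (towerPt lam) (rename Sum.inl t : MvPolynomial (GraphVars n ⊕ κ) ℂ) = 0 := by
  rw [aeval_towerPt_rename_inl, (mem_graphIdeal_iff_graphRestrict t).mp ht, map_zero]

omit [Fintype κ] in
/-- The fibre gradient of an embedded generator `F_q` is the standard vector `e_{c_q}`. -/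
theorem towerRow_generator (lam : κ → K) (q : Fin n × Fin n) :
    towerRow lam (rename Sum.inl (generator n q) : MvPolynomial (GraphVars n ⊕ κ) ℂ) =
      Pi.single (Sum.inl q) 1 := by
  classical
  funext y
  rw [towerRow_apply, generator, map_sub, map_sum]
  simp only [map_mul, rename_X, map_sub, map_sum, Derivation.leibniz, pderiv_X, smul_eq_mul]
  rcases y with q' | i
  · simp only [Sum.elim_inl]
    by_cases h : q' = q
    · subst h
      simp
    · simp [h, Ne.symm h]
  · simp

/-! ### Partial derivatives outside the range of a renaming -/

omit [Fintype κ] [DecidableEq κ] in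
/-- A partial derivative in a variable outside the range of a renaming vanishes. -/
theorem pderiv_rename_of_forall_ne {σ τ : Type*} (f : σ → τ) (j : τ) (hj : ∀ i, f i ≠ j)
    (p : MvPolynomial σ ℂ) : pderiv j (rename f p) = 0 := by
  classical
  induction p using MvPolynomial.induction_on with
  | C a => simp
  | add p q hp hq => simp [hp, hq]
  | mul_X p i hp =>
    rw [map_mul, rename_X, Derivation.leibniz, hp, smul_zero, add_zero, pderiv_X,
      Pi.single_eq_of_ne (hj i), smul_zero]

/-! ### The next ring: embedding, point, rows of embedded polynomials -/

omit [Fintype κ] [DecidableEq κ] [Algebra ℂ K] in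
/-- The next point restricts to the old one along `ι = Sum.map id Sum.inl`. -/
theorem towerPt_sumElim_comp (lam : κ → K) (μ : (Fin n × Fin n) ⊕ κ → K) :
    towerPt (n := n) (Sum.elim lam μ) ∘ Sum.map id Sum.inl = towerPt lam := by
  funext w; rcases w with v | i <;> rfl

omit [Fintype κ] [DecidableEq κ] in
/-- Embedded polynomials keep their value at the next point. -/
theorem aeval_towerPt_rename_ι (lam : κ → K) (μ : (Fin n × Fin n) ⊕ κ → K)
    (p : MvPolynomial (GraphVars n ⊕ κ) ℂ) :
    aeval (towerPt (Sum.elim lam μ)) (rename (Sum.map id Sum.inl) p) = aeval (towerPt lam) p := by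
  rw [aeval_rename, towerPt_sumElim_comp]

omit [Fintype κ] [DecidableEq κ] in
/-- Rows of embedded polynomials: old coordinates unchanged, fresh coordinates zero. -/
theorem towerRow_rename_ι (lam : κ → K) (μ : (Fin n × Fin n) ⊕ κ → K)
    (g : MvPolynomial (GraphVars n ⊕ κ) ℂ) :
    (towerRow (Sum.elim lam μ) (rename (Sum.map id Sum.inl) g) : (Fin n × Fin n) ⊕ _ → K) =
      Sum.elim (fun q => towerRow lam g (Sum.inl q))
        (Sum.elim (fun i => towerRow lam g (Sum.inr i)) fun _ => 0) := by
  have hinj : Function.Injective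
      (Sum.map id Sum.inl : GraphVars n ⊕ κ → GraphVars n ⊕ (κ ⊕ ((Fin n × Fin n) ⊕ κ))) :=
    Sum.map_injective.mpr ⟨Function.injective_id, Sum.inl_injective⟩
  funext y
  rcases y with q | i | x
  · rw [towerRow_apply, Sum.elim_inl, Sum.elim_inl,
      show (Sum.inl (Sum.inr q) : GraphVars n ⊕ (κ ⊕ ((Fin n × Fin n) ⊕ κ))) =
        Sum.map id Sum.inl (Sum.inl (Sum.inr q)) from rfl,
      pderiv_rename hinj, aeval_towerPt_rename_ι, towerRow_apply, Sum.elim_inl]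
  · rw [towerRow_apply, Sum.elim_inr, Sum.elim_inr, Sum.elim_inl,
      show (Sum.inr (Sum.inl i) : GraphVars n ⊕ (κ ⊕ ((Fin n × Fin n) ⊕ κ))) =
        Sum.map id Sum.inl (Sum.inr i) from rfl,
      pderiv_rename hinj, aeval_towerPt_rename_ι, towerRow_apply, Sum.elim_inr]
  · rw [towerRow_apply, Sum.elim_inr, Sum.elim_inr, Sum.elim_inr,
      pderiv_rename_of_forall_ne _ _ (fun w => by rcases w with v | i <;> simp), map_zero]

/-! ### Transported and stage derivations -/

/-- An old stage derivation transported to the next ring (zero on the fresh variables). -/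
def liftDer (D : Derivation ℂ (MvPolynomial (GraphVars n ⊕ κ) ℂ) (MvPolynomial (GraphVars n ⊕ κ) ℂ)) :
    Derivation ℂ (MvPolynomial (GraphVars n ⊕ (κ ⊕ ((Fin n × Fin n) ⊕ κ))) ℂ)
      (MvPolynomial (GraphVars n ⊕ (κ ⊕ ((Fin n × Fin n) ⊕ κ))) ℂ) :=
  mkDerivation ℂ (Sum.elim (fun v => rename (Sum.map id Sum.inl) (D (X (Sum.inl v))))
    (Sum.elim (fun i => rename (Sum.map id Sum.inl) (D (X (Sum.inr i)))) fun _ => 0))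

omit [Fintype κ] [DecidableEq κ] in
/-- `liftDer D` extends `D` along `ι`. -/
theorem liftDer_rename (D : Derivation ℂ (MvPolynomial (GraphVars n ⊕ κ) ℂ)
    (MvPolynomial (GraphVars n ⊕ κ) ℂ)) (p : MvPolynomial (GraphVars n ⊕ κ) ℂ) :
    liftDer D (rename (Sum.map id Sum.inl) p) = rename (Sum.map id Sum.inl) (D p) :=
  mkDerivation_rename_eq _ D _ (fun w => by rcases w with v | i <;> rfl) p

omit [Fintype κ] [DecidableEq κ] in
/-- Folds of transported derivations of an embedded polynomial. -/
theorem foldl_liftDer_rename (w : List (Derivation ℂ (MvPolynomial (GraphVars n ⊕ κ) ℂ)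
    (MvPolynomial (GraphVars n ⊕ κ) ℂ))) (p : MvPolynomial (GraphVars n ⊕ κ) ℂ) :
    (w.map liftDer).foldl (fun acc D => D acc) (rename (Sum.map id Sum.inl) p) =
      rename (Sum.map id Sum.inl) (w.foldl (fun acc D => D acc) p) := by
  induction w generalizing p with
  | nil => rfl
  | cons D w ih => rw [List.map_cons, List.foldl_cons, List.foldl_cons, liftDer_rename, ih]

omit [Fintype κ] [DecidableEq κ] in
/-- Renaming preserves cost-free polynomials. -/
theorem rename_mem_freeSpan_empty {σ τ : Type*} (f : σ → τ) {p : MvPolynomial σ ℂ}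
    (hp : p ∈ freeSpan (∅ : Set (MvPolynomial σ ℂ))) :
    rename f p ∈ freeSpan (∅ : Set (MvPolynomial τ ℂ)) := by
  unfold freeSpan at hp ⊢
  refine Submodule.span_induction (p := fun x _ => rename f x ∈ _) ?_ ?_ ?_ ?_ hp
  · rintro x (rfl | ⟨⟨i, rfl⟩ | h⟩)
    · rw [map_one]; exact Submodule.subset_span (Set.mem_insert _ _)
    · rw [rename_X]
      exact Submodule.subset_span (Set.mem_insert_of_mem _ (Or.inl ⟨f i, rfl⟩))
    · exact absurd h (Set.notMem_empty _)
  · rw [map_zero]; exact Submodule.zero_mem _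
  · intro x y _ _ hx hy; rw [map_add]; exact Submodule.add_mem _ hx hy
  · intro c x _ hx; rw [map_smul]; exact Submodule.smul_mem _ c hx

omit [Fintype κ] [DecidableEq κ] in
/-- A derivation with cost-free values maps cost-free polynomials to cost-free polynomials. -/
theorem derivation_mem_freeSpan_empty {σ : Type*} {D : Derivation ℂ (MvPolynomial σ ℂ) (MvPolynomial σ ℂ)}
    (hD : ∀ v, D (X v) ∈ freeSpan ∅) {p : MvPolynomial σ ℂ}
    (hp : p ∈ freeSpan (∅ : Set (MvPolynomial σ ℂ))) : D p ∈ freeSpan (∅ : Set (MvPolynomial σ ℂ)) := by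
  unfold freeSpan at hp
  refine Submodule.span_induction (p := fun x _ => D x ∈ _) ?_ ?_ ?_ ?_ hp
  · rintro x (rfl | ⟨⟨i, rfl⟩ | h⟩)
    · rw [Derivation.map_one_eq_zero]; exact Submodule.zero_mem _
    · exact hD i
    · exact absurd h (Set.notMem_empty _)
  · rw [map_zero]; exact Submodule.zero_mem _
  · intro x y _ _ hx hy; rw [map_add]; exact Submodule.add_mem _ hx hy
  · intro c x _ hx; rw [Derivation.map_smul]; exact Submodule.smul_mem _ c hx

omit [Fintype κ] [DecidableEq κ] in
/-- Transported derivations keep cost-free values. -/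
theorem liftDer_X_mem_freeSpan {D : Derivation ℂ (MvPolynomial (GraphVars n ⊕ κ) ℂ)
    (MvPolynomial (GraphVars n ⊕ κ) ℂ)} (hD : ∀ v, D (X v) ∈ freeSpan ∅) (v') :
    liftDer D (X v') ∈ freeSpan ∅ := by
  rw [liftDer, mkDerivation_X]
  rcases v' with v | i | x
  · exact rename_mem_freeSpan_empty _ (hD _)
  · exact rename_mem_freeSpan_empty _ (hD _)
  · exact Submodule.zero_mem _

omit [Fintype κ] [DecidableEq κ] in
/-- Transported derivations still kill `a, b`. -/
theorem liftDer_X_base {D : Derivation ℂ (MvPolynomial (GraphVars n ⊕ κ) ℂ)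
    (MvPolynomial (GraphVars n ⊕ κ) ℂ)} (hD : ∀ v : MatMulVars n, D (X (Sum.inl (Sum.inl v))) = 0)
    (v : MatMulVars n) : liftDer D (X (Sum.inl (Sum.inl v))) = 0 := by
  rw [liftDer, mkDerivation_X, Sum.elim_inl, hD, map_zero]

/-- The STAGE DERIVATION `∑_x λ_x ∂_x` of the next ring: every old fibre coordinate `x` goes to its
fresh variable `λ_x`; `a, b` and the fresh variables go to `0`. -/
def stageDer (n : ℕ) (κ : Type) :
    Derivation ℂ (MvPolynomial (GraphVars n ⊕ (κ ⊕ ((Fin n × Fin n) ⊕ κ))) ℂ)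
      (MvPolynomial (GraphVars n ⊕ (κ ⊕ ((Fin n × Fin n) ⊕ κ))) ℂ) :=
  mkDerivation ℂ (Sum.elim (Sum.elim (fun _ => 0) fun q => X (Sum.inr (Sum.inr (Sum.inl q))))
    (Sum.elim (fun i => X (Sum.inr (Sum.inr (Sum.inr i)))) fun _ => 0))

omit [Fintype κ] [DecidableEq κ] in
/-- The stage derivation kills `a, b`. -/
@[simp] theorem stageDer_X_base (v : MatMulVars n) :
    stageDer n κ (X (Sum.inl (Sum.inl v))) = 0 := by
  rw [stageDer, mkDerivation_X]; rfl

omit [Fintype κ] [DecidableEq κ] in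
/-- The stage derivation sends `c_q` to `λ_{c_q}`. -/
@[simp] theorem stageDer_X_c (q : Fin n × Fin n) :
    stageDer n κ (X (Sum.inl (Sum.inr q))) = X (Sum.inr (Sum.inr (Sum.inl q))) := by
  rw [stageDer, mkDerivation_X]; rfl

omit [Fintype κ] [DecidableEq κ] in
/-- The stage derivation sends an old kernel variable `Λ_i` to `λ_{Λ_i}`. -/
@[simp] theorem stageDer_X_old (i : κ) :
    stageDer n κ (X (Sum.inr (Sum.inl i))) = X (Sum.inr (Sum.inr (Sum.inr i))) := by
  rw [stageDer, mkDerivation_X]; rfl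

omit [Fintype κ] [DecidableEq κ] in
/-- The stage derivation kills the fresh variables. -/
@[simp] theorem stageDer_X_new (x : (Fin n × Fin n) ⊕ κ) :
    stageDer n κ (X (Sum.inr (Sum.inr x))) = 0 := by
  rw [stageDer, mkDerivation_X]; rfl

omit [Fintype κ] [DecidableEq κ] in
/-- The stage derivation has cost-free values. -/
theorem stageDer_X_mem_freeSpan (v) : stageDer n κ (X v) ∈ freeSpan ∅ := by
  rcases v with (v | q) | i | x
  · rw [stageDer_X_base]; exact Submodule.zero_mem _
  · rw [stageDer_X_c]; exact X_mem_freeSpan _ _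
  · rw [stageDer_X_old]; exact X_mem_freeSpan _ _
  · rw [stageDer_X_new]; exact Submodule.zero_mem _

omit [DecidableEq κ] in
/-- Reindexing a sum over the variables of the next ring whose `a, b` and fresh terms vanish. -/
theorem sum_nextVars_eq {M : Type*} [AddCommMonoid M]
    (T : GraphVars n ⊕ (κ ⊕ ((Fin n × Fin n) ⊕ κ)) → M)
    (h0 : ∀ v : MatMulVars n, T (Sum.inl (Sum.inl v)) = 0)
    (h3 : ∀ x : (Fin n × Fin n) ⊕ κ, T (Sum.inr (Sum.inr x)) = 0) :
    ∑ v', T v' = ∑ y : (Fin n × Fin n) ⊕ κ,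
      Sum.elim (fun q => T (Sum.inl (Sum.inr q))) (fun i => T (Sum.inr (Sum.inl i))) y := by
  have e1 : ∑ v', T v' = ∑ v, T (Sum.inl v) + ∑ k, T (Sum.inr k) := Fintype.sum_sum_type _
  have e2 : ∑ v : GraphVars n, T (Sum.inl v) =
      ∑ v : MatMulVars n, T (Sum.inl (Sum.inl v)) + ∑ q : Fin n × Fin n, T (Sum.inl (Sum.inr q)) :=
    Fintype.sum_sum_type _
  have e3 : ∑ k : κ ⊕ ((Fin n × Fin n) ⊕ κ), T (Sum.inr k) =
      ∑ i : κ, T (Sum.inr (Sum.inl i)) + ∑ x : (Fin n × Fin n) ⊕ κ, T (Sum.inr (Sum.inr x)) :=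
    Fintype.sum_sum_type _
  have e4 : ∑ y : (Fin n × Fin n) ⊕ κ,
      Sum.elim (fun q => T (Sum.inl (Sum.inr q))) (fun i => T (Sum.inr (Sum.inl i))) y =
      ∑ q : Fin n × Fin n, T (Sum.inl (Sum.inr q)) + ∑ i : κ, T (Sum.inr (Sum.inl i)) :=
    Fintype.sum_sum_type _
  rw [e1, e2, e3, e4, Finset.sum_eq_zero (fun v _ => h0 v), zero_add,
    Finset.sum_eq_zero (fun x _ => h3 x), add_zero]

omit [DecidableEq κ] in
/-- **The stage derivation of an embedded polynomial**: `D (ι g) = ∑_y ι(∂_y g) · λ_y`. -/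
theorem stageDer_rename (g : MvPolynomial (GraphVars n ⊕ κ) ℂ) :
    stageDer n κ (rename (Sum.map id Sum.inl) g) =
      ∑ y : (Fin n × Fin n) ⊕ κ, rename (Sum.map id Sum.inl)
        (pderiv (Sum.elim (fun q => Sum.inl (Sum.inr q)) Sum.inr y) g) * X (Sum.inr (Sum.inr y)) := by
  classical
  have hinj : Function.Injective
      (Sum.map id Sum.inl : GraphVars n ⊕ κ → GraphVars n ⊕ (κ ⊕ ((Fin n × Fin n) ⊕ κ))) :=
    Sum.map_injective.mpr ⟨Function.injective_id, Sum.inl_injective⟩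
  rw [derivation_apply_eq_sum_pderiv]
  refine (sum_nextVars_eq (fun v' => pderiv v' (rename (Sum.map id Sum.inl) g) * stageDer n κ (X v'))
    (fun v => by simp only [stageDer_X_base, mul_zero])
    (fun x => by simp only [stageDer_X_new, mul_zero])).trans (Finset.sum_congr rfl fun y _ => ?_)
  rcases y with q | i
  · simp only [Sum.elim_inl]
    rw [stageDer_X_c, show (Sum.inl (Sum.inr q) : GraphVars n ⊕ (κ ⊕ ((Fin n × Fin n) ⊕ κ))) =
      Sum.map id Sum.inl (Sum.inl (Sum.inr q)) from rfl, pderiv_rename hinj]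
  · simp only [Sum.elim_inr]
    rw [stageDer_X_old, show (Sum.inr (Sum.inl i) : GraphVars n ⊕ (κ ⊕ ((Fin n × Fin n) ⊕ κ))) =
      Sum.map id Sum.inl (Sum.inr i) from rfl, pderiv_rename hinj]

omit [DecidableEq κ] in
/-- **Value of the stage derivative at the next point**: `(D (ι g))(pt') = ∑_y row(g)_y μ_y`. -/
theorem aeval_stageDer_rename (lam : κ → K) (μ : (Fin n × Fin n) ⊕ κ → K)
    (g : MvPolynomial (GraphVars n ⊕ κ) ℂ) :
    aeval (towerPt (Sum.elim lam μ)) (stageDer n κ (rename (Sum.map id Sum.inl) g)) =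
      ∑ y, towerRow lam g y * μ y := by
  rw [stageDer_rename, map_sum]
  exact Finset.sum_congr rfl fun y _ => by
    rw [map_mul, aeval_towerPt_rename_ι, aeval_X, towerRow_apply]; rfl

/-- **Fresh-block gradient of the stage derivative**: `∂_{λ_x} (D (ι g)) (pt') = row(g)_x`. -/
theorem towerRow_stageDer_rename_new (lam : κ → K) (μ : (Fin n × Fin n) ⊕ κ → K)
    (g : MvPolynomial (GraphVars n ⊕ κ) ℂ) (x : (Fin n × Fin n) ⊕ κ) :
    towerRow (Sum.elim lam μ) (stageDer n κ (rename (Sum.map id Sum.inl) g)) (Sum.inr (Sum.inr x)) =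
      towerRow lam g x := by
  classical
  rw [towerRow_apply, Sum.elim_inr, stageDer_rename, map_sum, map_sum]
  simp_rw [Derivation.leibniz, smul_eq_mul, map_add, map_mul,
    pderiv_rename_of_forall_ne (Sum.map id Sum.inl) (Sum.inr (Sum.inr x) : GraphVars n ⊕ (κ ⊕ _))
      (fun w => by rcases w with v | i <;> simp), map_zero, mul_zero, add_zero, pderiv_X,
    aeval_towerPt_rename_ι]
  rw [Finset.sum_eq_single x (fun y _ hy => by
    rw [Pi.single_eq_of_ne (fun h => hy (Sum.inr_injective (Sum.inr_injective h))), map_zero,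
      mul_zero]) (fun h => absurd (Finset.mem_univ x) h), Pi.single_eq_same, map_one, mul_one,
    towerRow_apply]

/-! ### Normalisers -/

omit [Fintype κ] in
/-- The normaliser `λ_x - w` is cost-free, has value `μ_x - w` and gradient `e_{λ_x}`. -/
theorem normaliser_facts (lam : κ → K) (μ : (Fin n × Fin n) ⊕ κ → K) (x : (Fin n × Fin n) ⊕ κ)
    (w : ℂ) :
    (X (Sum.inr (Sum.inr x)) - C w :
        MvPolynomial (GraphVars n ⊕ (κ ⊕ ((Fin n × Fin n) ⊕ κ))) ℂ) ∈ freeSpan ∅ ∧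
      aeval (towerPt (Sum.elim lam μ)) (X (Sum.inr (Sum.inr x)) - C w :
        MvPolynomial (GraphVars n ⊕ (κ ⊕ ((Fin n × Fin n) ⊕ κ))) ℂ) = μ x - algebraMap ℂ K w ∧
      towerRow (Sum.elim lam μ) (X (Sum.inr (Sum.inr x)) - C w :
        MvPolynomial (GraphVars n ⊕ (κ ⊕ ((Fin n × Fin n) ⊕ κ))) ℂ) =
        Pi.single (Sum.inr (Sum.inr x)) 1 := by
  classical
  refine ⟨Submodule.sub_mem _ (X_mem_freeSpan _ _) (C_mem_freeSpan _ _), ?_, ?_⟩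
  · rw [map_sub, aeval_X, aeval_C]; rfl
  · funext y
    rw [towerRow_apply, map_sub, pderiv_C, sub_zero, pderiv_X]
    rcases y with q | i | x'
    · rw [Sum.elim_inl, Pi.single_eq_of_ne (by simp), Pi.single_eq_of_ne (by simp), map_zero]
    · rw [Sum.elim_inr, Pi.single_eq_of_ne (by simp), Pi.single_eq_of_ne (by simp), map_zero]
    · rw [Sum.elim_inr]
      by_cases h : x' = x
      · subst h; rw [Pi.single_eq_same, Pi.single_eq_same, map_one]
      · simp [h, Ne.symm h]

end Frame

end Summit.MatrixMultiplication.MatrixMultiplication.Theorems.GraphEquations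

end
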